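import Mathlib.LinearAlgebra.Matrix.AbsoluteValue
import Mathlib.LinearAlgebra.Matrix.Adjugate
import Mathlib.LinearAlgebra.Matrix.NonsingularInverse
import Mathlib.LinearAlgebra.Dual.Lemmas
import Mathlib.LinearAlgebra.FiniteDimensional.Lemmas
import Mathlib.Data.Real.Basic
import HarnessLib

/-!
# Vertices of polyhedra with `0/±1` rows (the linear algebra behind Muroga's weight bound)

Two lemmas of linear programming folklore, in the form used by the weight-reduction theorem
for threshold gates (`ThresholdWeightBound.lean`; Muroga 1971; Håstad 1994, §3 "Recalling the
upper bound"):

* `ThresholdWeights.exists_feasible_tightSpan_eq_top` — a nonempty polyhedron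
  `{u ∈ ℝᵈ | bᵢ ≤ rᵢ · u}` whose rows `rᵢ` span `ℝᵈ` has a point at which the TIGHT rows span
  `ℝᵈ` (a vertex). Proof: a feasible point with the maximal rank of tight rows; if that rank were
  `< d`, move along a direction killed by all tight rows until a new row becomes tight
  (Håstad 1994, §3: "let `t₀` be the minimal `t > 0` such that `|H₀(x) + tH₁(x)| = 1` for some
  `x` …; this implies that we violate the maximality condition");
* `ThresholdWeights.exists_int_mul_of_tightSpan_eq_top` — if the rows and right-hand sides
  are integers of absolute value `≤ 1`, such a vertex `u` satisfies `D·u ∈ ℤᵈ` for some integer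
  `0 < D` with `|D·uⱼ| ≤ d!` (Cramer's rule on `d` independent tight rows, and the determinant
  bound `|det| ≤ d!` for `0/±1` matrices, Mathlib's `Matrix.det_le`, in place of Hadamard's
  inequality; Håstad 1994, §3: "each coefficient of `H₀` is given by the ratio of two
  `(n+1) × (n+1)` determinants with entries in `{-1, 1}`").

## References

* J. Håstad, *On the size of weights for threshold gates*, SIAM J. Discrete Math. 7 (1994)
  484–492, §3 [Hastad1994].
* S. Muroga, *Threshold Logic and Its Applications*, Wiley 1971, Thm. 9.3.2.1 [Muroga1971].
-/

namespace Literature.Computability.Complexity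

namespace ThresholdWeights

open Matrix Module Submodule Finset

variable {ι : Type*} [Fintype ι] {d : ℕ}

/-- The polyhedron `{u | ∀ i, bᵢ ≤ rᵢ · u}`. [folklore] -/
def Feasible (r : ι → Fin d → ℝ) (b : ι → ℝ) (u : Fin d → ℝ) : Prop := ∀ i, b i ≤ r i ⬝ᵥ u

/-- The span of the rows that are tight at `u`. [folklore] -/
def tightSpan (r : ι → Fin d → ℝ) (b : ι → ℝ) (u : Fin d → ℝ) : Submodule ℝ (Fin d → ℝ) :=
  span ℝ (r '' {i | r i ⬝ᵥ u = b i})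

/-- **One pivoting step.** If the tight rows at a feasible point do not yet span `ℝᵈ` (while
all rows do), one can move to a feasible point whose tight rows span strictly more
(Håstad 1994, §3, the maximality argument). [cite: Hastad1994, Section 3] -/
theorem exists_feasible_tightSpan_gt (r : ι → Fin d → ℝ) (b : ι → ℝ)
    (hspan : span ℝ (Set.range r) = ⊤) (u : Fin d → ℝ) (hu : Feasible r b u)
    (hlt : tightSpan r b u < ⊤) :
    ∃ u', Feasible r b u' ∧ tightSpan r b u < tightSpan r b u' := by
  classical
  obtain ⟨f, hf0, hker⟩ := Submodule.exists_le_ker_of_lt_top _ hlt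
  -- some row is not killed by `f`
  have hex : ∃ i, f (r i) ≠ 0 := by
    by_contra h
    have h' : ∀ i, f (r i) = 0 := fun i => by_contra fun hne => h ⟨i, hne⟩
    apply hf0
    have htop : (⊤ : Submodule ℝ (Fin d → ℝ)) ≤ LinearMap.ker f := by
      rw [← hspan, Submodule.span_le]
      rintro _ ⟨i, rfl⟩
      exact h' i
    exact LinearMap.ker_eq_top.1 (top_le_iff.1 htop)
  -- a functional `g` killing the tight rows and negative on some row
  obtain ⟨g, hgker, i₀, hi₀⟩ : ∃ g : (Fin d → ℝ) →ₗ[ℝ] ℝ,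
      tightSpan r b u ≤ LinearMap.ker g ∧ ∃ i, g (r i) < 0 := by
    obtain ⟨i, hi⟩ := hex
    rcases lt_or_gt_of_ne hi with h | h
    · exact ⟨f, hker, i, h⟩
    · refine ⟨-f, fun x hx => ?_, i, by simpa using h⟩
      have := hker hx
      rw [LinearMap.mem_ker] at this ⊢
      simp [this]
  -- the direction `v` with `x · v = g x`
  set v : Fin d → ℝ := fun j => g (fun k => if j = k then (1 : ℝ) else 0) with hv
  have hgv : ∀ x : Fin d → ℝ, x ⬝ᵥ v = g x := fun x => by
    rw [LinearMap.pi_apply_eq_sum_univ g x]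
    simp [dotProduct, hv, smul_eq_mul]
  -- the blocking rows and the step length
  set R := univ.filter (fun i => g (r i) < 0) with hR
  have hRne : R.Nonempty := ⟨i₀, by simp [hR, hi₀]⟩
  obtain ⟨istar, histar, hmin⟩ :=
    R.exists_min_image (fun i => (r i ⬝ᵥ u - b i) / (- g (r i))) hRne
  have hgstar : g (r istar) < 0 := by simpa [hR] using histar
  set lam := (r istar ⬝ᵥ u - b istar) / (- g (r istar)) with hlam
  have hlam0 : 0 ≤ lam := div_nonneg (sub_nonneg.2 (hu istar)) (by linarith)
  have hstep : ∀ i, r i ⬝ᵥ (u + lam • v) = r i ⬝ᵥ u + lam * g (r i) := fun i => by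
    rw [dotProduct_add, dotProduct_smul, hgv, smul_eq_mul]
  have htight_old : ∀ i, r i ⬝ᵥ u = b i → g (r i) = 0 := fun i hi => by
    have : r i ∈ tightSpan r b u := Submodule.subset_span ⟨i, hi, rfl⟩
    exact LinearMap.mem_ker.1 (hgker this)
  have hnew : r istar ⬝ᵥ (u + lam • v) = b istar := by
    rw [hstep]
    have hg0 : g (r istar) ≠ 0 := hgstar.ne
    have : lam * g (r istar) = -(r istar ⬝ᵥ u - b istar) := by
      rw [hlam, div_neg, neg_mul, div_mul_cancel₀ _ hg0]
    rw [this]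
    ring
  refine ⟨u + lam • v, fun i => ?_, ?_⟩
  · -- feasibility of the new point
    rw [hstep]
    by_cases hi : g (r i) < 0
    · have hiR : i ∈ R := by simp [hR, hi]
      have hle := hmin i hiR
      rw [le_div_iff₀ (by linarith)] at hle
      have : lam * -g (r i) = -(lam * g (r i)) := by ring
      linarith
    · have hi' : 0 ≤ g (r i) := not_lt.1 hi
      have := hu i
      have : 0 ≤ lam * g (r i) := mul_nonneg hlam0 hi'
      linarith
  · -- the tight span grows strictly
    refine SetLike.lt_iff_le_and_exists.2 ⟨Submodule.span_mono ?_, r istar, ?_, fun hmem => ?_⟩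
    · rintro _ ⟨i, hi, rfl⟩
      refine ⟨i, ?_, rfl⟩
      show r i ⬝ᵥ (u + lam • v) = b i
      rw [hstep, htight_old i hi, mul_zero, add_zero]
      exact hi
    · exact Submodule.subset_span ⟨istar, hnew, rfl⟩
    · exact (LinearMap.mem_ker.1 (hgker hmem) ▸ hgstar).false

/-- **A vertex exists**: a nonempty polyhedron `{u | bᵢ ≤ rᵢ · u}` whose rows span `ℝᵈ` has a
feasible point at which the tight rows span `ℝᵈ` (Håstad 1994, §3: the linear function `H₀`
maximizing the number of tight points "is uniquely determined by the equations"). [cite: Hastad1994, Section 3] -/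
theorem exists_feasible_tightSpan_eq_top (r : ι → Fin d → ℝ) (b : ι → ℝ)
    (hspan : span ℝ (Set.range r) = ⊤) (hne : ∃ u, Feasible r b u) :
    ∃ u, Feasible r b u ∧ tightSpan r b u = ⊤ := by
  set S : Set ℕ := {m | ∃ u, Feasible r b u ∧ finrank ℝ (tightSpan r b u) = m} with hS
  have hSne : S.Nonempty := by
    obtain ⟨u, hu⟩ := hne
    exact ⟨_, u, hu, rfl⟩
  have hSbdd : BddAbove S := ⟨d, by
    rintro m ⟨u, -, rfl⟩
    exact (Submodule.finrank_le _).trans (finrank_fin_fun ℝ).le⟩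
  obtain ⟨u, hu, hm⟩ := Nat.sSup_mem hSne hSbdd
  refine ⟨u, hu, ?_⟩
  by_contra hne'
  obtain ⟨u', hu', hlt⟩ :=
    exists_feasible_tightSpan_gt r b hspan u hu (lt_top_iff_ne_top.2 hne')
  have h1 : finrank ℝ (tightSpan r b u) < finrank ℝ (tightSpan r b u') :=
    Submodule.finrank_lt_finrank_of_lt hlt
  have h2 : finrank ℝ (tightSpan r b u') ≤ sSup S := le_csSup hSbdd ⟨u', hu', rfl⟩
  omega

/-- **Cramer's rule at a vertex with `0/±1` data.** If the rows `rᵢ ∈ {0, ±1}ᵈ` tight at `u`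
(for right-hand sides `bᵢ ∈ {0, ±1}`) span `ℝᵈ`, then `D·u` is an integer vector with entries of
absolute value at most `d!`, for some integer `D > 0` (Håstad 1994, §3: Cramer's rule and the
determinant bound; here `|det| ≤ d!` for `0/±1` matrices, Mathlib's `Matrix.det_le`). [cite: Hastad1994, Section 3] -/
theorem exists_int_mul_of_tightSpan_eq_top (r₀ : ι → Fin d → ℤ) (b₀ : ι → ℤ)
    (hr : ∀ i j, |r₀ i j| ≤ 1) (hb : ∀ i, |b₀ i| ≤ 1) (u : Fin d → ℝ)
    (htop : tightSpan (fun i j => (r₀ i j : ℝ)) (fun i => (b₀ i : ℝ)) u = ⊤) :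
    ∃ (z : Fin d → ℤ) (D : ℕ), 0 < D ∧ (∀ j, |z j| ≤ (d.factorial : ℤ)) ∧
      ∀ j, (z j : ℝ) = (D : ℝ) * u j := by
  classical
  set r : ι → Fin d → ℝ := fun i j => (r₀ i j : ℝ) with hrdef
  set b : ι → ℝ := fun i => (b₀ i : ℝ) with hbdef
  set T : Set ι := {i | r i ⬝ᵥ u = b i} with hT
  obtain ⟨B, hBT, hBspan, hli⟩ := exists_linearIndependent ℝ (r '' T)
  have hBfin : B.Finite :=
    ((Set.finite_range r).subset (Set.image_subset_range _ _)).subset hBT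
  haveI : Fintype B := hBfin.fintype
  have hcard : Fintype.card B = d := by
    have h := finrank_span_eq_card hli
    rw [Subtype.range_coe, hBspan] at h
    change finrank ℝ (tightSpan r b u) = _ at h
    rw [htop, finrank_top, finrank_fin_fun] at h
    exact h.symm
  set e : Fin d ≃ B := (Fintype.equivFinOfCardEq hcard).symm with he
  have hidx : ∀ k : Fin d, ∃ i, i ∈ T ∧ r i = (e k : Fin d → ℝ) := fun k => by
    obtain ⟨i, hi, hi'⟩ := hBT (e k).2
    exact ⟨i, hi, hi'⟩
  choose idx hidxT hidxr using hidx
  set A₀ : Matrix (Fin d) (Fin d) ℤ := fun k => r₀ (idx k) with hA₀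
  set A : Matrix (Fin d) (Fin d) ℝ := fun k => r (idx k) with hA
  have hAmap : A₀.map (Int.cast : ℤ → ℝ) = A := rfl
  have hArows : LinearIndependent ℝ A.row := by
    have : A.row = Subtype.val ∘ e := funext fun k => hidxr k
    rw [this]
    exact hli.comp e e.injective
  have hAunit : IsUnit A := Matrix.linearIndependent_rows_iff_isUnit.1 hArows
  have hdet : A.det ≠ 0 := ((Matrix.isUnit_iff_isUnit_det A).1 hAunit).ne_zero
  set β₀ : Fin d → ℤ := fun k => b₀ (idx k) with hβ₀
  set β : Fin d → ℝ := fun k => (β₀ k : ℝ) with hβ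
  have hAu : A *ᵥ u = β := funext fun k => hidxT k
  have hcramer : A.det • u = A.cramer β := by
    rw [Matrix.cramer_eq_adjugate_mulVec, ← hAu, Matrix.mulVec_mulVec, Matrix.adjugate_mul,
      Matrix.smul_mulVec, Matrix.one_mulVec]
  have hdetcast : (A₀.det : ℝ) = A.det := by
    rw [← hAmap]
    exact RingHom.map_det (Int.castRingHom ℝ) A₀
  have hdet₀ : A₀.det ≠ 0 := fun h => hdet (by rw [← hdetcast, h, Int.cast_zero])
  refine ⟨fun j => A₀.det.sign * (A₀.updateCol j β₀).det, A₀.det.natAbs,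
    Int.natAbs_pos.2 hdet₀, fun j => ?_, fun j => ?_⟩
  · -- the bound `|det| ≤ d!` for a `0/±1` matrix
    have hle : |(A₀.updateCol j β₀).det| ≤ (d.factorial : ℤ) := by
      have h := Matrix.det_le (A := A₀.updateCol j β₀) (abv := AbsoluteValue.abs) (x := (1 : ℤ))
        (fun k j' => by
          rw [AbsoluteValue.abs_apply, Matrix.updateCol_apply]
          split_ifs
          · exact hb _
          · exact hr _ _)
      simpa using h
    rw [abs_mul, Int.abs_sign_of_ne_zero hdet₀, one_mul]
    exact hle
  · -- Cramer: `sign(det A₀) · det(A₀ with column j replaced by β₀) = |det A₀| · uⱼ`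
    have h2 : (Int.castRingHom ℝ).mapMatrix (A₀.updateCol j β₀) = A.updateCol j β := by
      ext k j'
      simp only [RingHom.mapMatrix_apply, Matrix.map_apply, Matrix.updateCol_apply]
      split_ifs <;> rfl
    have h1 : ((A₀.updateCol j β₀).det : ℝ) = A.det * u j := by
      have := congrFun hcramer j
      rw [Pi.smul_apply, smul_eq_mul, Matrix.cramer_apply] at this
      rw [this, ← h2, ← RingHom.map_det, eq_intCast]
    rw [Int.cast_mul, h1, ← hdetcast, ← mul_assoc, ← Int.cast_mul, Int.sign_mul_self_eq_natAbs,
      Int.cast_natCast]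

end ThresholdWeights

end Literature.Computability.Complexity
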